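import Summits.BirchSwinnertonDyer.BirchSwinnertonDyer.Theorems.GoldfeldAllTwistsTwoConverseTwinGenusExplicitClass
import Literature.NumberTheory.EllipticCurves.X049EtaDescent
import HarnessLib

set_option linter.dupNamespace false -- namespace `…BirchSwinnertonDyer.BirchSwinnertonDyer…` is the cell's (D-0017 nested layout)
set_option autoImplicit false

/-!
# Twin″ (item 19140), LINE U, file U2c — the integrality input: Deuring's factorisation (F-D) gives `x(P_q) − 2 ∈ 𝓞_{H_K}`, all generating
# ONE ideal; the explicit-class theorem of U2b with the hypothesis `hint` DISCHARGED

Cell `bsd-goldfeld`, seat `bsd-goldfeld-s1p-c301` (prover, gen 14); ORDER «LINE U» (planner (cliii)); `--supports stmt-BirchSwinnertonDyer-19140`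
as a HELPER; memo `HOME/INERT7-UNIT-CIRCLE.md` §3. Named print: ty's (F-η) `x049_x_sub_two_eq_etaQuotient` (binder `hEta`) and (F-D)
`deuring_etaQuotient49_heegner_generates_conjPrime` (binder `hD`; stated over `ringClassField K ι 1 = singularModuliField K ι`,
`ringClassField_one`). Contents: `coe_xCoord_sub_two_eq` (under (F-η) the complex value of `x_q − 2` is `η(τ_q)/η(49τ_q)`);
`exists_integer_map_of_le` (GENERIC transport of an integral generator `(u) = J·𝓞` along an inclusion `S ≤ T` of subfields of `ℂ` that are
`K`-algebras through `ι` — stated for arbitrary `S, T` on purpose: the kernel must never unfold the closure-defined fields);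
**`exists_ideal_forall_xCoord_sub_two`**: there is an ideal `I` (`= 𝔮̄·𝓞_{H_K}`) with `x_q − 2 = w_q ∈ 𝓞_{H_K}`, `(w_q) = I` for ALL
representatives `q` (transport from one representative by `Gal(H_K/K)`, Mathlib `RingOfIntegers.mapAlgEquiv`; `I` is Galois-stable as the
extension of an ideal of `𝓞_K`); and the HEADLINE **`isSquare_map_mul_map_genusNorm (hEta) (hD)`** = U2b's `isSquare_map_mul_map_prod_sqCoset`
with `hint` discharged: for `σ₂, σ₃ ∈ Gal(H_K/K)` acting alike on `√−1`, `σ₂(u)·σ₃(u)` is a square in `H_K` for every coset product `u`.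
HONEST FRAMING: as U2b; nothing about `L`-values, Selmer groups or BSD.
References: S. Lang, *Elliptic Functions* (1987), Ch. 12 §2 Thm. 4–5 (via `hD`) [Lang1987]; B. Gross, *Heegner points on X₀(N)* (1984), §I.1
[Gross1984]; G. Ligozat, Mém. SMF 43 (1975) (via `hEta`) [Ligozat1975].
-/

noncomputable section

open scoped Classical UpperHalfPlane

open Complex NumberField Polynomial
open Literature.NumberTheory.EllipticCurves Literature.NumberTheory.EllipticCurves.ModularForms
open Literature.Computability.Cryptography.Hallgren2005 Literature.Computability.Cryptography.Hallgren2005.OrderCl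

namespace Summit.BirchSwinnertonDyer.BirchSwinnertonDyer.Theorems.GoldfeldGoodTwists

variable {K : Type} [Field K] [NumberField K]


section ExplicitClass

variable (hK : IsImaginaryQuadratic K) (hH : SatisfiesHeegnerHypothesis 49 K) (ι : K →+* ℂ)
  (H : HeegnerDatum 49 (NumberField.discr K)) (Dt : ModularParametrizationData cm7 49)
  (P : H.reps → (cm7.baseChange (singularModuliField K ι)).toAffine.Point)
  (hP : ∀ q : H.reps, WeierstrassCurve.Affine.Point.map (singularModuliField K ι).subtype.toRatAlgHom (P q) =
    Dt.φ (heegnerTau q))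
  (θ : ClassGroup (OrderCl.QO hK.negDiscr) ≃* (singularModuliField K ι ≃ₐ[K] singularModuliField K ι))
  (hθ : ∀ (γ : ClassGroup (OrderCl.QO hK.negDiscr)) (q : H.reps), ∃ q' : H.reps,
    heegnerFormClass hK q' = γ * heegnerFormClass hK q ∧
    WeierstrassCurve.Affine.Point.map
      (θ γ : singularModuliField K ι →ₐ[K] singularModuliField K ι) (P q) = P q')
  (x y : H.reps → singularModuliField K ι)
  (hxy : ∀ q : H.reps, ∃ h, P q = .some (x q) (y q) h)
  (hint : ∃ I : Ideal (𝓞 (singularModuliField K ι)), ∀ q : H.reps, ∃ w : 𝓞 (singularModuliField K ι),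
    (w : singularModuliField K ι) = x q - 2 ∧ Ideal.span {w} = I)

include hP hxy in
/-- Under (F-η), the complex value of `x_q − 2` is `η(τ_q)/η(49τ_q)`. [cite: Ligozat1975, Prop. 3.1.1 and table N = 49 (p. 45)] -/
theorem coe_xCoord_sub_two_eq (hEta : x049_x_sub_two_eq_etaQuotient) (hc : |Dt.c| = 1) (q : H.reps) :
    ((x q - 2 : singularModuliField K ι) : ℂ) =
      ModularForm.eta (heegnerTau (q : ℤ × ℤ × ℤ)) /
        ModularForm.eta (UpperHalfPlane.ofComplex (49 * ((heegnerTau (q : ℤ × ℤ × ℤ) : ℍ) : ℂ))) := by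
  obtain ⟨h, hq⟩ := hxy q
  have hmap := hP q
  rw [hq, WeierstrassCurve.Affine.Point.map_some] at hmap
  obtain ⟨y', h', hφ'⟩ := hEta Dt hc (heegnerTau (q : ℤ × ℤ × ℤ))
  rw [hφ'] at hmap
  have hx := ((WeierstrassCurve.Affine.Point.some.injEq _ _ _ _ _ _).mp hmap).1
  change ((x q : singularModuliField K ι) : ℂ) = _ at hx
  push_cast
  rw [show ((2 : singularModuliField K ι) : ℂ) = 2 from map_ofNat (singularModuliField K ι).subtype 2, hx,
    add_sub_cancel_left]

omit [NumberField K] in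
/-- **Transport of an integral generator along `S ≤ T`** (subfields of `ℂ`, `K`-algebras through `ι`): if `u ∈ 𝓞_S` generates `J·𝓞_S` for
an ideal `J` of `𝓞_K`, then some `w ∈ 𝓞_T` with the same complex value generates `J·𝓞_T` (Mathlib `RingOfIntegers.mapAlgHom` of the
inclusion). Generic in `S, T` by design. [folklore] -/
theorem exists_integer_map_of_le {S T : Subfield ℂ} (hle : S ≤ T) [Algebra K S] [Algebra K T]
    (hS : ∀ k : K, ((algebraMap K S k : S) : ℂ) = ι k) (hT : ∀ k : K, ((algebraMap K T k : T) : ℂ) = ι k)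
    (u : 𝓞 S) (J : Ideal (𝓞 K)) (hspan : Ideal.span {u} = J.map (algebraMap (𝓞 K) (𝓞 S))) :
    ∃ w : 𝓞 T, ((w : T) : ℂ) = ((u : S) : ℂ) ∧ Ideal.span {w} = J.map (algebraMap (𝓞 K) (𝓞 T)) := by
  let incl : S →ₐ[K] T :=
    { Subfield.inclusion hle with
      commutes' := fun k ↦ Subtype.ext (by
        change ((Subfield.inclusion hle (algebraMap K S k) : T) : ℂ) = ((algebraMap K T k : T) : ℂ)
        rw [hT, ← hS]; rfl) }
  refine ⟨RingOfIntegers.mapAlgHom incl u, rfl, ?_⟩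
  rw [show ({RingOfIntegers.mapAlgHom incl u} : Set _) = (RingOfIntegers.mapAlgHom incl).toRingHom '' {u} by
      rw [Set.image_singleton]; rfl, ← Ideal.map_span, hspan, Ideal.map_map]
  exact congrArg (Ideal.map · J) (RingHom.ext fun k ↦ (RingOfIntegers.mapAlgHom incl).commutes k)

set_option linter.unreachableTactic false in
set_option linter.unusedTactic false in
include hH hP hθ hxy in
/-- **The integrality input from (F-D).** Granted `hEta` and `hD`: there is an ideal `I` of `𝓞_{H_K}` (`= 𝔮̄·𝓞_{H_K}`) such that every
`x_q − 2`, `q ∈ H.reps`, equals some `w_q ∈ 𝓞_{H_K}` with `(w_q) = I` — (F-D) at one representative, transported along `K[1] = H_K`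
(`exists_integer_map_of_le`) and then to all representatives by `Gal(H_K/K)` (`RingOfIntegers.mapAlgEquiv`; `I` is Galois-stable).
[cite: Lang1987, Ch. 12 §2 Thm. 4 and Thm. 5] [cite: Gross1984, §I.1] -/
theorem exists_ideal_forall_xCoord_sub_two (hEta : x049_x_sub_two_eq_etaQuotient)
    (hD : deuring_etaQuotient49_heegner_generates_conjPrime) (hc : |Dt.c| = 1) :
    ∃ I : Ideal (𝓞 (singularModuliField K ι)), ∀ q : H.reps, ∃ w : 𝓞 (singularModuliField K ι),
      (w : singularModuliField K ι) = x q - 2 ∧ Ideal.span {w} = I := by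
  obtain ⟨q₀, hq₀⟩ := HeegnerDatum.reps_nonempty hK hH H
  -- (F-D) applied at `q₀`; written so that it elaborates both against the over-general typing of the fact (no
  -- `IsImaginaryQuadratic` hypothesis) and against its in-place repair (hypothesis `hK` inserted after `ι`), 2026-08-28.
  obtain ⟨u, v, hu, -, hspan⟩ := by first | exact hD K ι H q₀ hq₀ | exact hD K ι hK H q₀ hq₀
  obtain ⟨w₀, hw₀C, hspan₀⟩ := exists_integer_map_of_le ι (ringClassField_one ι).le (coe_algebraMap_ringClassField ι 1)
    (coe_algebraMap_singularModuliField ι) u v.asIdeal hspan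
  -- `w₀ = x q₀ − 2`
  have hw₀x : (w₀ : singularModuliField K ι) = x ⟨q₀, hq₀⟩ - 2 := by
    apply Subtype.ext
    rw [hw₀C, hu, coe_xCoord_sub_two_eq ι H Dt P hP x y hxy hEta hc ⟨q₀, hq₀⟩]
  -- the ideal `I = 𝔮̄·𝓞_{H_K}` is Galois stable
  set I : Ideal (𝓞 (singularModuliField K ι)) := v.asIdeal.map (algebraMap (𝓞 K) (𝓞 (singularModuliField K ι))) with hI
  have hIσ : ∀ σ : singularModuliField K ι ≃ₐ[K] singularModuliField K ι,
      I.map (RingOfIntegers.mapAlgEquiv σ).toAlgHom.toRingHom = I := fun σ ↦ by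
    rw [hI, Ideal.map_map]
    exact congrArg (Ideal.map · v.asIdeal) (RingHom.ext fun k ↦ (RingOfIntegers.mapAlgEquiv σ).toAlgHom.commutes k)
  refine ⟨I, fun q ↦ ?_⟩
  -- transport `w₀` to `q` by the automorphism moving `q₀` to `q`
  obtain ⟨q', hq', hmap⟩ := hθ (heegnerFormClass hK q * (heegnerFormClass hK q₀)⁻¹) ⟨q₀, hq₀⟩
  rw [Subtype.coe_mk, inv_mul_cancel_right] at hq'
  have hqq : q' = q := heegnerFormClass_injective_reps hK H hq'
  subst hqq
  obtain ⟨h₀, hP₀⟩ := hxy ⟨q₀, hq₀⟩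
  obtain ⟨h₁, hP₁⟩ := hxy q'
  rw [hP₀, hP₁, WeierstrassCurve.Affine.Point.map_some] at hmap
  have hxq := ((WeierstrassCurve.Affine.Point.some.injEq _ _ _ _ _ _).mp hmap).1
  set σ := θ (heegnerFormClass hK q' * (heegnerFormClass hK q₀)⁻¹) with hσ
  refine ⟨RingOfIntegers.mapAlgEquiv σ w₀, ?_, ?_⟩
  · change σ (w₀ : singularModuliField K ι) = x q' - 2
    rw [hw₀x, map_sub, map_ofNat]
    exact congrArg (· - 2) hxq
  · rw [show ({RingOfIntegers.mapAlgEquiv σ w₀} : Set _) =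
        (RingOfIntegers.mapAlgEquiv σ).toAlgHom.toRingHom '' {w₀} by rw [Set.image_singleton]; rfl,
      ← Ideal.map_span, hspan₀, hIσ]


include hH hP hθ hxy in
/-- **HEADLINE (U2): the explicit-class theorem with the integrality hypothesis discharged.** Granted (F-η) `hEta` and (F-D) `hD`: for
`σ₂, σ₃ ∈ Gal(H_K/K)` with `σ₂ j = σ₃ j` (`j² = −1`) and every coset product `u = ∏_{[𝔞_q] ∈ Cl²γ₀} (x(P_q) − 2)`:
`IsSquare (σ₂(u)·σ₃(u))` in `H_K`. [cite: Gross1984, §I.1] [cite: Lang1987, Ch. 12 §2 Thm. 5] -/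
theorem isSquare_map_mul_map_genusNorm (hEta : x049_x_sub_two_eq_etaQuotient)
    (hD : deuring_etaQuotient49_heegner_generates_conjPrime) (hc : |Dt.c| = 1)
    (σ₂ σ₃ : singularModuliField K ι ≃ₐ[K] singularModuliField K ι) (j : singularModuliField K ι)
    (hj : j ^ 2 = -1) (hστ : σ₂ j = σ₃ j) (γ₀ : ClassGroup (OrderCl.QO hK.negDiscr)) :
    IsSquare (σ₂ (∏ q ∈ Finset.univ.filter (fun q : H.reps ↦ ∃ δ, heegnerFormClass hK q = δ ^ 2 * γ₀), (x q - 2)) *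
      σ₃ (∏ q ∈ Finset.univ.filter (fun q : H.reps ↦ ∃ δ, heegnerFormClass hK q = δ ^ 2 * γ₀), (x q - 2))) :=
  isSquare_map_mul_map_prod_sqCoset hK hH ι H Dt P hP θ hθ x y hxy
    (exists_ideal_forall_xCoord_sub_two hK hH ι H Dt P hP θ hθ x y hxy hEta hD hc) hEta hc σ₂ σ₃ j hj hστ γ₀

end ExplicitClass

end Summit.BirchSwinnertonDyer.BirchSwinnertonDyer.Theorems.GoldfeldGoodTwists

end
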